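import Mathlib
import Summits.Ventures.PercRepro2.HCov
import Summits.Ventures.PercRepro2.A3RootEdge

/-!
# The root-edge closure of (HCOV), part II: `HCov p[e ↦ 0] → HCov p` for an edge `e = {a₁, a₃}`
(blind cell PercRepro2, p5 g13; `proofs/P5-ROOTEDGE.md` §1–§2, S4 §2.4 (n) addendum (vii);
part I = `A3RootEdge.lean`: the pinned structure, the gluing identities, `g1_nonneg`, `dfc_nonneg`,
`dgc_nonneg`)

Let `e` be an edge between `a₃` and the root `a₁`, `t = p e`, `p₀ = p[e ↦ 0]` (the instance `G − e`),
`p₁ = p[e ↦ 1]` (`e` surely open: `a₃ ∈ C₁`).  The law of total covariance over the status of `e`,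
at the FIXED constant `γ = γ_G = γ_{G−e}` (`PD ⊆ {e closed}`), gives the exact cleared identity

  `Q₀·Q₁·Gc(p) = (1 − t)²·Q·Q₁·Gc(p₀) + t(1 − t)·[D₀·Q·Q₀·g₁ + (1 − t)·df·dg]`

(**`key_identity`**; `Q = P_p(Q)`, `Q₀ = P₀(Q)`, `Q₁ = P₁(Q)`, `D₀ = P₀(PD)`): the twelve pattern
masses of `Gc` are pinned (`prob_eq_pin`), the `PD`- and `T`-masses at `p₁` vanish and its `T′`-masses
are `Q`-masses (part I), and the rest is `ring`.  With the three pieces nonnegative (part I):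

* **`HCov_of_update_zero`**: `HCov p[e ↦ 0] → HCov p` — (HCOV) is closed under adding an edge between
  `a₃` and a root; by induction the crux `HCov_all` reduces to graphs in which `a₃` has no root edge.
  Degenerate cases: `Q₀ = 0` forces `D = D_o = 0` at `p` and `Gc = 0` (`Gc_eq_zero_of_D_Do`);
  `Q₁ = 0` kills every `p₁`-atom and `Gc(p) = (1 − t)³·Gc(p₀)` (`Gc_eq_of_Q_one_zero`);
* `HCov_of_update_zero'`: the same with the edge written `s(a₃, a₁)`.
-/

namespace Summit.Ventures.PercRepro2

open UnionCluster

namespace CovForm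

namespace RootEdge

open CCT A3Fibre

/-! ### The cleared identity and the closure theorem -/

section Main

variable {V : Type*} {E : Type*} [Fintype V] [DecidableEq V] [Fintype E] [DecidableEq E]
  {R : Type*} [Field R] [LinearOrder R] [IsStrictOrderedRing R]

omit [Fintype V] [DecidableEq V] in
/-- **The cleared e-split identity at a root edge** (P5-ROOTEDGE.md §2):
`Q₀·Q₁·Gc(p) = (1 − t)²·Q·Q₁·Gc(p₀) + t(1 − t)·[D₀·Q·Q₀·g₁ + (1 − t)·df·dg]`. -/
theorem key_identity (p : E → R) (ends : E → Sym2 V) (o a₁ a₂ a₃ b : V) (e : E)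
    (hends : ends e = s(a₁, a₃)) :
    prob (Function.update p e 0) (avoidAll ends a₂ {a₁}) *
        prob (Function.update p e 1) (avoidAll ends a₂ {a₁}) * Gc p ends o a₁ a₂ a₃ b =
      (1 - p e) ^ 2 * prob p (avoidAll ends a₂ {a₁}) *
          prob (Function.update p e 1) (avoidAll ends a₂ {a₁}) *
          Gc (Function.update p e 0) ends o a₁ a₂ a₃ b +
        p e * (1 - p e) *
          (prob (Function.update p e 0) (PDEvent ends a₁ a₂ a₃) * prob p (avoidAll ends a₂ {a₁}) *
              prob (Function.update p e 0) (avoidAll ends a₂ {a₁}) *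
              (-2 * (prob (Function.update p e 1) (avoidAll ends a₂ {a₁}) *
                (prob (Function.update p e 1)
                    (avoidAll ends a₂ {a₁} ∩ (connEvent ends a₂ o ∩ connEvent ends a₁ b)) -
                  prob (Function.update p e 1)
                    (avoidAll ends a₂ {a₁} ∩ (connEvent ends a₂ o ∩ connEvent ends a₂ b))) -
                (prob (Function.update p e 1) (avoidAll ends a₂ {a₁} ∩ connEvent ends a₁ b) -
                    prob (Function.update p e 1) (avoidAll ends a₂ {a₁} ∩ connEvent ends a₂ b)) *
                  prob (Function.update p e 1) (avoidAll ends a₂ {a₁} ∩ connEvent ends a₂ o))) +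
            (1 - p e) *
              (prob (Function.update p e 0) (avoidAll ends a₂ {a₁}) *
                  (prob (Function.update p e 1) (avoidAll ends a₂ {a₁} ∩ connEvent ends a₁ b) -
                    prob (Function.update p e 1) (avoidAll ends a₂ {a₁} ∩ connEvent ends a₂ b)) -
                prob (Function.update p e 1) (avoidAll ends a₂ {a₁}) *
                  (prob (Function.update p e 0) (avoidAll ends a₂ {a₁} ∩ connEvent ends a₁ b) -
                    prob (Function.update p e 0) (avoidAll ends a₂ {a₁} ∩ connEvent ends a₂ b))) *
              (Do (Function.update p e 0) ends o a₁ a₂ a₃ *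
                    prob (Function.update p e 0) (avoidAll ends a₂ {a₁}) *
                    prob (Function.update p e 1) (avoidAll ends a₂ {a₁}) -
                  2 * prob (Function.update p e 1) (avoidAll ends a₂ {a₁} ∩ connEvent ends a₂ o) *
                    prob (Function.update p e 0) (PDEvent ends a₁ a₂ a₃) *
                    prob (Function.update p e 0) (avoidAll ends a₂ {a₁}) -
                  DEF (Function.update p e 0) ends o a₁ a₂ a₃ *
                    prob (Function.update p e 1) (avoidAll ends a₂ {a₁}))) := by
  have hpin : ∀ A : Set (Config E), prob p A =
      p e * prob (Function.update p e 1) A + (1 - p e) * prob (Function.update p e 0) A :=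
    fun A => prob_eq_pin p A e
  unfold Gc DEF EQbo EQb3 EQb3o EQo EQ3 EQ3o PDb PDbo Do
  rw [gap_eq_Q p, gap_eq_Q (Function.update p e 0)]
  simp only [hpin, prob_one_PD_inter p hends a₂, prob_one_T_inter p hends a₂,
    prob_one_T'_inter p hends a₂, prob_one_PD p hends a₂, prob_one_T p hends a₂,
    prob_one_T' p hends a₂]
  ring

omit [Fintype V] [DecidableEq V] [LinearOrder R] [IsStrictOrderedRing R] in
/-- `Gc` vanishes when `D = D_o = 0` (every term carries one of them). -/
lemma Gc_eq_zero_of_D_Do (p : E → R) (ends : E → Sym2 V) (o a₁ a₂ a₃ b : V)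
    (hD : prob p (PDEvent ends a₁ a₂ a₃) = 0) (hDo : Do p ends o a₁ a₂ a₃ = 0) :
    Gc p ends o a₁ a₂ a₃ b = 0 := by
  unfold Gc DEF
  rw [hD, hDo]
  ring

omit [Fintype V] [DecidableEq V] in
/-- When `Q₁ = 0`, `Gc(p) = (1 − t)³·Gc(p₀)` (every `p₁`-atom of the pinned form vanishes). -/
lemma Gc_eq_of_Q_one_zero (p : E → R) (hp : IsProbVec p) (ends : E → Sym2 V) (o a₁ a₂ a₃ b : V)
    (e : E) (hends : ends e = s(a₁, a₃))
    (hQ1 : prob (Function.update p e 1) (avoidAll ends a₂ {a₁}) = 0) :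
    Gc p ends o a₁ a₂ a₃ b = (1 - p e) ^ 3 * Gc (Function.update p e 0) ends o a₁ a₂ a₃ b := by
  have hp₁ : IsProbVec (Function.update p e 1) := hp.update e zero_le_one le_rfl
  have hz : ∀ X : Set (Config E),
      prob (Function.update p e 1) (avoidAll ends a₂ {a₁} ∩ X) = 0 := fun X =>
    le_antisymm (le_trans (prob_mono hp₁ Set.inter_subset_left) hQ1.le) (prob_nonneg hp₁ _)
  have hpin : ∀ A : Set (Config E), prob p A =
      p e * prob (Function.update p e 1) A + (1 - p e) * prob (Function.update p e 0) A :=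
    fun A => prob_eq_pin p A e
  unfold Gc DEF EQbo EQb3 EQb3o EQo EQ3 EQ3o PDb PDbo Do
  rw [gap_eq_Q p, gap_eq_Q (Function.update p e 0)]
  simp only [hpin, prob_one_PD_inter p hends a₂, prob_one_T_inter p hends a₂,
    prob_one_T'_inter p hends a₂, prob_one_PD p hends a₂, prob_one_T p hends a₂,
    prob_one_T' p hends a₂, hz, hQ1]
  ring

/-- **THE ROOT-EDGE CLOSURE OF (HCOV)**: for an edge `e = {a₁, a₃}` between `a₃` and the root `a₁`,
`(HCOV)` at `p[e ↦ 0]` (the instance without `e`) implies `(HCOV)` at `p`. -/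
theorem HCov_of_update_zero (p : E → R) (hp : IsProbVec p) (ends : E → Sym2 V) (o a₁ a₂ a₃ b : V)
    (e : E) (hends : ends e = s(a₁, a₃))
    (h₀ : HCov (Function.update p e 0) ends o a₁ a₂ a₃ b) : HCov p ends o a₁ a₂ a₃ b := by
  have hp₀ : IsProbVec (Function.update p e 0) := hp.update e le_rfl zero_le_one
  have hp₁ : IsProbVec (Function.update p e 1) := hp.update e zero_le_one le_rfl
  unfold HCov at h₀ ⊢
  have ht0 : 0 ≤ p e := hp.nonneg e
  have ht1 : 0 ≤ 1 - p e := sub_nonneg.2 (hp.le_one e)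
  have hQ := prob_nonneg hp (avoidAll ends a₂ {a₁})
  have hQ0 := prob_nonneg hp₀ (avoidAll ends a₂ {a₁})
  have hQ1 := prob_nonneg hp₁ (avoidAll ends a₂ {a₁})
  have hD0 := prob_nonneg hp₀ (PDEvent ends a₁ a₂ a₃)
  by_cases hQ0z : prob (Function.update p e 0) (avoidAll ends a₂ {a₁}) = 0
  · -- `D = D_o = 0` at `p`: `Gc = 0`
    have hPD0 : prob (Function.update p e 0) (PDEvent ends a₁ a₂ a₃) = 0 := by
      refine le_antisymm (le_trans (prob_mono hp₀ ?_) hQ0z.le) hD0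
      intro ω hω
      rw [avoidAll_eq_compl']
      exact hω.1
    have hD : prob p (PDEvent ends a₁ a₂ a₃) = 0 := by
      rw [prob_eq_pin p _ e, prob_one_PD p hends a₂, hPD0]; ring
    have hDo : Do p ends o a₁ a₂ a₃ = 0 := by
      have h1 : prob p (PDEvent ends a₁ a₂ a₃ ∩ connEvent ends a₁ o) = 0 :=
        le_antisymm (le_trans (prob_mono hp Set.inter_subset_left) hD.le) (prob_nonneg hp _)
      have h2 : prob p (PDEvent ends a₁ a₂ a₃ ∩ connEvent ends a₂ o) = 0 :=
        le_antisymm (le_trans (prob_mono hp Set.inter_subset_left) hD.le) (prob_nonneg hp _)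
      unfold Do; rw [h1, h2]; ring
    rw [Gc_eq_zero_of_D_Do p ends o a₁ a₂ a₃ b hD hDo]
  by_cases hQ1z : prob (Function.update p e 1) (avoidAll ends a₂ {a₁}) = 0
  · rw [Gc_eq_of_Q_one_zero p hp ends o a₁ a₂ a₃ b e hends hQ1z]
    exact mul_nonneg (pow_nonneg ht1 3) h₀
  · have hid := key_identity p ends o a₁ a₂ a₃ b e hends
    have hg := g1_nonneg (Function.update p e 1) hp₁ ends o a₁ a₂ b
    have hf := dfc_nonneg p hp ends a₁ a₂ a₃ b e hends
    have hgg := dgc_nonneg p hp ends o a₁ a₂ a₃ e hends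
    have hR : 0 ≤ prob (Function.update p e 0) (avoidAll ends a₂ {a₁}) *
        prob (Function.update p e 1) (avoidAll ends a₂ {a₁}) * Gc p ends o a₁ a₂ a₃ b := by
      rw [hid]
      refine add_nonneg (mul_nonneg (mul_nonneg (mul_nonneg (pow_nonneg ht1 2) hQ) hQ1) h₀) ?_
      refine mul_nonneg (mul_nonneg ht0 ht1) (add_nonneg ?_ ?_)
      · exact mul_nonneg (mul_nonneg (mul_nonneg hD0 hQ) hQ0) hg
      · exact mul_nonneg (mul_nonneg ht1 hf) hgg
    have hpos : 0 < prob (Function.update p e 0) (avoidAll ends a₂ {a₁}) *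
        prob (Function.update p e 1) (avoidAll ends a₂ {a₁}) :=
      mul_pos (lt_of_le_of_ne hQ0 (Ne.symm hQ0z)) (lt_of_le_of_ne hQ1 (Ne.symm hQ1z))
    exact le_of_mul_le_mul_left (by rw [mul_zero]; exact hR) hpos

/-- The same with the edge written `s(a₃, a₁)`. -/
theorem HCov_of_update_zero' (p : E → R) (hp : IsProbVec p) (ends : E → Sym2 V) (o a₁ a₂ a₃ b : V)
    (e : E) (hends : ends e = s(a₃, a₁))
    (h₀ : HCov (Function.update p e 0) ends o a₁ a₂ a₃ b) : HCov p ends o a₁ a₂ a₃ b :=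
  HCov_of_update_zero p hp ends o a₁ a₂ a₃ b e (by rw [hends, Sym2.eq_swap]) h₀

end Main

end RootEdge

end CovForm

end Summit.Ventures.PercRepro2
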